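import Literature.Computability.MetaComplexity.McKayMurrayWilliams2019.UniformStreaming
import Summits.PneNP.PneNP.Theorems.SoloBlindStreamingNerode
import HarnessLib

/-!
# Online compression: streaming with canonical representatives and short names (tool for THEOREM E♯)

Support file for the kernel form of THEOREM E♯ of the solo report.  The one-pass streaming
algorithm behind THEOREM E♯ keeps, after the prefix `p` of an input of length `N`, a NAME of the
canonical representative `rep N p` of the Myhill–Nerode class of `p` (`NerodeStream.cls L N p`,
`SoloBlindStreamingNerode.lean`): on the next bit `b` it decodes the name to the representative
`y`, forms `y ++ [b]`, canonises and re-encodes.  This file isolates the purely combinatorial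
part of that construction, with the representative map `rep`, the naming map `enc` and its
decoder `dec` as parameters:

* `OC.alg L rep enc dec` — the algorithm (empty initial state);
* `OC.reach_alg` — along a run the state IS the name of the canonical representative:
  `reach (OC.alg …) N p = enc N (rep N p)` for `|p| ≤ N`;
* `OC.decides_alg` — it decides `L`; `OC.runsInSpace_alg` — its space is the name length;
* `OC.update_reach`, `OC.accept_finalState` — the update / acceptance identities in the shape
  consumed by `Pad.hasUniformUpdateTime_of_codeFP` / `Pad.hasUniformReportTime_of_codeFP`.

Hypotheses: `rep N p ∈ cls L N p` and `rep` constant on classes (canonicity), `enc N [] = []`,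
and `dec N (enc N (rep N p)) = rep N p` — all for `|p| ≤ N`.  All statements proved.

References: J. E. Hopcroft, J. D. Ullman, *Introduction to Automata Theory, Languages, and
Computation* (1979), §3.4 (Myhill–Nerode: the state of the minimal automaton is the class of the
prefix); D. M. McKay, C. D. Murray, R. R. Williams, STOC 2019, §2 (streaming algorithms).
-/

noncomputable section

namespace Summit.PneNP.PneNP.Theorems.SoloBlind

open Literature.Computability.Complexity Literature.Computability.MetaComplexity
open Literature.Computability.MetaComplexity.McKayMurrayWilliams2019

namespace OC

variable (L : Language Bool) (rep enc dec : ℕ → List Bool → List Bool)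

/-- **The online-compression algorithm**: state = name of the canonical representative of the
class of the prefix read so far; update = decode, append the bit, canonise, encode; accept iff the
decoded representative is in `L`. [Hopcroft–Ullman 1979, §3.4] [folklore] -/
def alg : StreamingAlgorithm where
  init _ := []
  update N σ b := enc N (rep N (dec N σ ++ [b]))
  accept N σ := L.boolIndicator (dec N σ)

variable {L rep enc dec}

/-- The canonical representative of the empty prefix is empty. [folklore] -/
theorem rep_nil (hR1 : ∀ N p, p.length ≤ N → rep N p ∈ NerodeStream.cls L N p) (N : ℕ) :
    rep N [] = [] :=
  List.eq_nil_of_length_eq_zero (NerodeStream.length_eq_of_mem_cls (hR1 N [] (Nat.zero_le _)))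

/-- **Run invariant**: after a prefix `p` with `|p| ≤ N` the state is the name of the canonical
representative of the class of `p`. [Hopcroft–Ullman 1979, §3.4] [folklore] -/
theorem reach_alg (hR1 : ∀ N p, p.length ≤ N → rep N p ∈ NerodeStream.cls L N p)
    (hR2 : ∀ N p p', p.length ≤ N → p' ∈ NerodeStream.cls L N p → rep N p' = rep N p)
    (hE0 : ∀ N, enc N [] = []) (hD : ∀ N p, p.length ≤ N → dec N (enc N (rep N p)) = rep N p)
    {N : ℕ} {p : List Bool} (hp : p.length ≤ N) :
    reach (alg L rep enc dec) N p = enc N (rep N p) := by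
  induction p using List.reverseRecOn with
  | nil => rw [reach_nil, rep_nil hR1, hE0]; rfl
  | append_singleton x b ih =>
    have hx : x.length ≤ N := by simp only [List.length_append, List.length_singleton] at hp; omega
    rw [reach_append_singleton, ih hx]
    show enc N (rep N (dec N (enc N (rep N x)) ++ [b])) = enc N (rep N (x ++ [b]))
    rw [hD N x hx, hR2 N (x ++ [b]) (rep N x ++ [b]) hp (NerodeStream.append_mem_cls (hR1 N x hx) [b])]

/-- **Correctness**: the online-compression algorithm decides `L`. [Hopcroft–Ullman 1979, §3.4]
[folklore] -/
theorem decides_alg (hR1 : ∀ N p, p.length ≤ N → rep N p ∈ NerodeStream.cls L N p)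
    (hR2 : ∀ N p p', p.length ≤ N → p' ∈ NerodeStream.cls L N p → rep N p' = rep N p)
    (hE0 : ∀ N, enc N [] = []) (hD : ∀ N p, p.length ≤ N → dec N (enc N (rep N p)) = rep N p) :
    (alg L rep enc dec).Decides L := by
  intro x
  rw [StreamingAlgorithm.Accepts, finalState_eq_reach, reach_alg hR1 hR2 hE0 hD le_rfl]
  show L.boolIndicator (dec x.length (enc x.length (rep x.length x))) = true ↔ x ∈ L
  rw [hD _ x le_rfl, ← Set.mem_iff_boolIndicator]
  exact (NerodeStream.mem_iff_of_mem_cls (hR1 _ x le_rfl) rfl).symm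

/-- **Space**: a bound on name lengths is a space bound on runs. [folklore] -/
theorem runsInSpace_alg (hR1 : ∀ N p, p.length ≤ N → rep N p ∈ NerodeStream.cls L N p)
    (hR2 : ∀ N p p', p.length ≤ N → p' ∈ NerodeStream.cls L N p → rep N p' = rep N p)
    (hE0 : ∀ N, enc N [] = []) (hD : ∀ N p, p.length ≤ N → dec N (enc N (rep N p)) = rep N p)
    {S : ℕ → ℕ} (hS : ∀ N p, p.length ≤ N → (enc N (rep N p)).length ≤ S N) :
    RunsInSpace (alg L rep enc dec) S := fun N p hp => by
  rw [reach_alg hR1 hR2 hE0 hD hp]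
  exact hS N p hp

/-- The update identity along runs, in the shape `u (N, N, σ, b)` of a map on padded codes.
[folklore] -/
theorem update_reach (N : ℕ) (x : List Bool) (b : Bool) :
    (fun t : ℕ × ℕ × (List Bool × Bool) => enc t.2.1 (rep t.2.1 (dec t.2.1 t.2.2.1 ++ [t.2.2.2])))
      (N, N, reach (alg L rep enc dec) N x, b) = reach (alg L rep enc dec) N (x ++ [b]) := by
  rw [reach_append_singleton]; rfl

/-- The acceptance identity, in the shape `r (N, N, σ)` of a map on padded codes. [folklore] -/
theorem accept_finalState (x : List Bool) :
    (fun t : ℕ × ℕ × List Bool => L.boolIndicator (dec t.2.1 t.2.2))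
      (x.length, x.length, (alg L rep enc dec).finalState x) =
      (alg L rep enc dec).accept x.length ((alg L rep enc dec).finalState x) := rfl

end OC

end Summit.PneNP.PneNP.Theorems.SoloBlind
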